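import Summits.CriticalPhenomena.PercolationContinuityZ3.Theorems.PercNearOneGluingNoHeavyPcintBSMZ7ChkU
import Summits.CriticalPhenomena.PercolationContinuityZ3.Theorems.PercNearOneGluingNoHeavyPcintBSMZ7ChkG0b
import Summits.CriticalPhenomena.PercolationContinuityZ3.Theorems.PercNearOneGluingNoHeavyPcintBSMZ7ChkG1b
import Summits.CriticalPhenomena.PercolationContinuityZ3.Theorems.PercNearOneGluingNoHeavyPcintBSMZ7ChkC1
import Summits.CriticalPhenomena.PercolationContinuityZ3.Theorems.PercNearOneGluingNoHeavyPcintBSMZ7ChkC2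
import Literature.Probability.Percolation.HypercubicAxisGrouping
import HarnessLib

/-!
# PCINT lane, PHASE 5 (block-renewal second moment): the cell `p_c^bond(ℤ^7) ≤ 0.1271`

Cell `prim-pcint`, seat `prim-pcint-1` (gen 14); memo `run/shared/lean/prim/pcint/T-FIBRE-ROUTE.md` §PHASE 5.
Instance `d = 7 = 4 + 3` (`k = 4` time axes, `t = 3` transverse axes), `β = 3/25` (`s = 4β = 12/25`),
horizon `N = 150`, cell `p = 1271/10^4`.
UNCONDITIONAL kernel certificate for the block-renewal second-moment bound (`BSM.criticalProb_le_of_checks`):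
semi-oriented block paths in `ℤ^7 = ℤ^4 × ℤ^3` (a block = a transverse piece of distinct signed axes with the
product-form endpoint law `g₃(s)^⊗3`, then one step along one of the `k = 4` time axes), second moment of the
number of open block paths bounded through a Lyapunov certificate for the pair-offset chain (potential `φ` on
`[-2,2]^3`, fixed-point Green sums to horizon `N = 150` plus the rational tail `Ctail/N`); every inequality is checked
by `decide +kernel` in natural/integer arithmetic.  Improves the lane's PHASE-4 cell (`…PcintOSMZ7`).
-/

noncomputable section

namespace Summit.CriticalPhenomena.PercolationContinuityZ3.Theorems.Pcint.BSM.Z7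

open Summit.CriticalPhenomena.PercolationContinuityZ3.Theorems.Pcint.BSM Literature.Probability.Percolation Literature.Probability.LatticeModels

/-- The certificate inequalities at the orbit representatives. -/
theorem hreps : CertOn reps3 :=
  forall_take_drop 1 hrep_1 (forall_drop_split 1 1 2 rfl hrep_2 (forall_drop_split 2 1 3 rfl hrep_3 (forall_drop_split 3 1 4 rfl hrep_4 (forall_drop_split 4 1 5 rfl hrep_5 (forall_drop_split 5 1 6 rfl hrep_6 (forall_drop_split 6 1 7 rfl hrep_7 (forall_drop_split 7 1 8 rfl hrep_8 (forall_drop_split 8 1 9 rfl hrep_9 hrep_10))))))))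

/-- All certificate inequalities on `[-2,2]^3` (orbit reduction `BSM.certZ_of_reps`). -/
theorem hcert : CertOn (boxList 3 2) :=
  certZ_of_reps pc3 pe3_eq W (k := kk) (by decide) (B := PP) (by decide) length_pc3 pi1 pi2 pi3 hpi1 hpi2 hpi3 hW1 hW2
    hW3 V0n V1n Φn V0n_gen V1n_gen Φn_gen _ _ reps3 wl2 hclos3 hreps

/-- **`p_c^bond(ℤ^7) ≤ 0.1271`** (block-renewal second moment, kernel certificate). -/
theorem criticalProb_Z7_le_1271 : criticalProb (zdGraph 7) (0 : Site 7) ≤ 0.1271 := by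
  have h := criticalProb_le_of_checks (t := 3) (k := kk) (by decide) pc3 pe3 pe3_eq 4 length_pc3
    (S3 pc3 kk) (fun y _ σ σ' => (S_eq_S3 pc3 kk y σ σ').symm) W DW (by decide) (a := aa) (b := bb) (by decide)
    (by decide) cube3 keyCube hmarg (P := PP) (by decide) (by decide) (N := NN) DD DU DG 1 Tn (by decide)
    (by decide) (by decide) (by decide) htail Ul Cl hU hC G0n G1n V0n V1n Φn CL36 canonK_mem_CL36 hG0 hG1 hV0 hV1
    hcert
  norm_num [kk, PP] at h
  exact h.trans (by norm_num)

/-- **`p_c^bond(ℤ^d') ≤ 0.1271` for every `d' ≥ 7`.** -/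
theorem criticalProb_zd_le_1271 {d' : ℕ} (hd : 7 ≤ d') : criticalProb (zdGraph d') (0 : Site d') ≤ 0.1271 :=
  (AxisGrouping.criticalProb_zd_anti hd).trans criticalProb_Z7_le_1271

end Summit.CriticalPhenomena.PercolationContinuityZ3.Theorems.Pcint.BSM.Z7

end
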